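import Summits.ABC.IUTFork.Joshi.BundlingRingsCrossNormUltrametric
import Summits.ABC.IUTFork.Joshi.PrototypeExponentModel
import Mathlib.RingTheory.MvPowerSeries.GaussNorm
import HarnessLib

/-!
# A NORMED model of E-t3's [J-IIp] carriers: NON-VACUITY of «Thm. 7.7.3.1 at `p` with both printed inputs discharged»
# (`localFundamentalEstimate_ofPrototypes_padic`, p437653) — the Gauss-norm polynomial period ring

Test-side support file of the abc-iut cell, block E «type Joshi's construction, test vs S» (rung LADDER-ABC:A2.E; seat
abc-iut-E-t13, gen 8; RE-SEAT POLICY (2): the ONE genuinely missing item of the seat's own map, namely HONEST LIMIT (b) of the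
module docstring of `Joshi/BundlingRingsCrossNormUltrametric.lean` (p437653, this seat's gen 2)). Companion of that file and of
abc-iut-E-t57's EXPONENT MODEL `Joshi/PrototypeExponentModel.lean` (whose point-side data are reused BY NAME: `ExpModel.expQ`,
`ExpModel.sc`, `ExpModel.lift`, `ExpModel.periodRingDatum`, `ExpModel.prototypeDatum`, `ExpModel.canonicalPoint`; E-t3's toolkit
`Model.absOne` / `Model.absPow`, `Joshi/ThetaValuesLocusModelPadic.lean`). SOURCE OF THE HYPOTHESES: K. Joshi, *Construction of
Arithmetic Teichmüller Spaces III*, arXiv:2401.13508v4 (`Joshi2024ATS3`, UNREFEREED, disputed in print), Thm. 7.7.3.1, p. 66 l. 62 –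
p. 67 l. 47, with inputs (7.7.3.2) (cross norm) and (7.7.3.3) (pilot lower bound); and K. Joshi, arXiv:2303.01662v3
(`Joshi2023ATS2Local`), §§6–9, for E-t3's signature `PeriodRingDatum` / `PrototypeDatum` / `CanonicalPoint` (p427971, p428639, p429136).

WHAT WAS OPEN. p437653 proved `ATS3.PrimeBundlingDatum.localFundamentalEstimate_ofPrototypes_padic`: Joshi's Thm. 7.7.3.1 at one
prime for the §7.5/§7.7 datum `ofPrototypes` on the LITERAL tensor ring `⨂[ℚ_p] w, B_{E′_w}` (projective norm), with BOTH printed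
inputs discharged in kernel — (7.7.3.3) from E-t3's typed [J-IIp] Thm. 9.2.1 (a `CanonicalPoint` of each prototype datum `P w`) and
(7.7.3.2) from E-t14's PROVED [Schneider 2002, Prop. 17.4] — leaving as hypotheses ONLY E-t3's signature fields and the identification
`hn : (P w).norm ρ x = ‖x‖` of the prototype's Fréchet norm (at the one `ρ` used) with the norm of an ULTRAMETRIC NORMED
`ℚ_p`-ALGEBRA structure on `B_{E′_w}` (Mathlib instances `NormedCommRing`, `NormedAlgebra ℚ_[p]`, `IsUltrametricDist`). Its
docstring (b) recorded that the JOINT satisfiability of these hypotheses was NOT shown: every kernel model of E-t3's carriers of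
record — E-t3's O1 model (p432971; `B := Q̄_p → Q̄_p`, evaluation seminorm), E-t57's exponent model (`B := ℚ → Q̄_p`, `|b|_ρ := ‖b(1)‖`),
E-t50/E-t52's Witt models (`B := MvPolynomial Q̄_p Q̄_p`, `|f| := max ‖a‖` over the variables of `f`) — norms `B` by a SEMINORM
(`|1| = 0` in the last; `|b| = 0` for every `b` vanishing at the evaluation point in the first two), so none supplies `hn`. An implication with
unsatisfiable hypotheses would carry no content (cf. E-t14's `not_crossNormClaimQp` episode recorded in p437653); this file closes (b).

WHY A GENUINE NORM IS NOT FREE HERE (two lines of arithmetic, for the referees). The signature forces, for every `a ∈ 𝔪_F ∖ 0`, a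
point `y_a = pt a` with `|p|_{K_{y_a}} = |a|_F` (`absK_pt`) and `= |p|_0^{scale y_a}` (`absK_emb`), so the canonical point `t`
(`|t|_F = |p|_0`) and its powers give points of EVERY scale `n ≥ 1`; `exists_teich_lift` at `y_{tⁿ}` gives `x_n ∈ F` with
`η_{y_{tⁿ}}([x_n]) = p` and `|x_n|_F = |p|_0^n`. If `η_y : B → K_y` were injective (e.g. `B` a normed FIELD), `[x_1] = p = [x_2]` in `B`,
and `norm_teich` (`|[x]|_ρ = |x|_F`) would give `|p|_0 = |p|_0²` — absurd. So `B` must have infinitely many distinct kernels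
`ker η_y ∋ p − [x_y]` (as Fontaine's `B` does: `y_t` IS the zero of `p − [t]`); a sup-normed function ring `Y → Q̄_p` with `η_y` =
evaluation fails too (`absK_eta_teich` forces `‖[x](y_{tⁿ})‖ = |x|_F^{1/n}`, so `‖[x]‖_sup ≥ sup_n |x|_F^{1/n} = 1 > |x|_F` on `𝔪_F ∖ 0`). The free commutative `ℚ_p`-algebra on the symbols `[x]` with a weighted Gauss norm
has both features, and that is the model.

THE MODEL (logical, not arithmetic-faithful; TAKES NO SIDE). `B := MvPolynomial Q̄_p ℚ_p` — one variable `X_x` per `x ∈ F := Q̄_p`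
(`PadicAlgCl p`, spectral norm) — normed by Mathlib's weighted GAUSS NORM `MvPowerSeries.gaussNorm` with coefficient valuation
`‖·‖_p` and weight `‖x‖` on `X_x` (weight `1` on the unused `X_0`): `‖Σ a_m X^m‖ := max_m ‖a_m‖_p · ∏_x ‖x‖^{m_x}`, a genuine
ultrametric submultiplicative `ℚ_p`-algebra norm (Mathlib: `gaussNorm_eq_zero_iff`, `gaussNorm_add_le_max`, `gaussNorm_mul_le`),
packaged as a `RingNorm` and — as DEFINITIONS, never instances — as `NormedCommRing` / `NormedAlgebra ℚ_[p]` structures used under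
`letI`. Fréchet norms `|f|_ρ := ‖f‖` for every `ρ`; Teichmüller map `[x] := X_x` (`[0] := 0`); `η_r := aeval (x ↦ ExpModel.lift p r x)`
(E-t57's sphere-wise rescaling `x ↦ x·c_r(‖x‖)`, `‖lift r x‖^{sc r} = ‖x‖`, onto); Frobenius and Galois trivial on `B`; `T_r := {0}`;
points `Y := ℚ`, `pt := ExpModel.expQ`, `ϕ(r) := p·r`, scales `ExpModel.sc`, `K_r := Q̄_p` with `‖·‖^{sc r}`, `E0 := Q̄_p`, `ι_r := id`,
`ℓ⋆ := 2`, `q := p^{10}`, `ξ := p`, canonical point `t := p`, `a := p^{1/4}` — all VERBATIM E-t57's fields (their proofs are reused as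
terms). Continuity is not part of the signature and is not modelled (`η_r` is not bounded for the Gauss norm).

RESULTS. §1 the Gauss norm on `B` and its structures (`gnorm_monomial`, `gnorm_X`, `gnorm_C`, `ringNorm`, `normedCommRing`,
`normedAlgebra`, `isUltrametricDist`); §2 the data `periodRingDatum` / `prototypeDatum` / `canonicalPoint`; §3 **`norm_eq`** (`hn`
holds by `rfl`), **`hypotheses_satisfiable`** (E-t3's `PrototypeDatum` + `CanonicalPoint` + `hn` jointly inhabited over an ultrametric
normed `ℚ_p`-algebra) and **`localFundamentalEstimate_gaussModel`** = p437653's `localFundamentalEstimate_ofPrototypes_padic`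
INSTANTIATED with every hypothesis discharged (one place `𝕍_p = 𝕍^{odd,ss}_p = {⋆}`, `ρ = 1`, `E′ := ℚ_p`, `B_p := ℚ_p`, comparison
map `0`): Joshi's Thm. 7.7.3.1 at `p`, as typed by this seat, is a theorem about a NON-EMPTY class of data. Registry effect only
(J3:Thm7.7.3.1 is not S-bearing: census-t13 PART D); no claim about Joshi's or Mochizuki's mathematics; no FACT-LIST row, no Prop
hypothesis, no sorry; standard axioms; no instance, notation or attribute is declared. Typed ≠ proved ≠ endorsed. [folklore] model-building.
-/

noncomputable section

open Set MvPolynomial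
open scoped TensorProduct

namespace Summit.ABC.IUTFork.Joshi.GaussModel

open Summit.ABC.IUTFork.Joshi.Model Summit.ABC.IUTFork.Joshi.ExpModel

variable (p : ℕ) [hp : Fact p.Prime]

/-! ## 1. The period ring `B := MvPolynomial Q̄_p ℚ_p` and its weighted Gauss norm -/

/-- The model period ring: the free commutative `ℚ_p`-algebra on the symbols `X_x`, `x ∈ Q̄_p` (the formal Teichmüllers). [folklore] -/
abbrev B : Type := MvPolynomial (PadicAlgCl p) ℚ_[p]

open scoped Classical in
/-- The Gauss weight of the variable `X_x`: `‖x‖` (and `1` for the unused `X_0`, so that all weights are positive). [folklore] -/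
def wt (x : PadicAlgCl p) : ℝ := if x = 0 then 1 else ‖x‖

/-- Weights are positive. [folklore] -/
theorem wt_pos (x : PadicAlgCl p) : 0 < wt p x := by
  unfold wt; split_ifs with h
  · exact one_pos
  · exact norm_pos_iff.2 h

/-- `wt x = ‖x‖` for `x ≠ 0`. [folklore] -/
theorem wt_of_ne_zero {x : PadicAlgCl p} (hx : x ≠ 0) : wt p x = ‖x‖ := by
  unfold wt; rw [if_neg hx]

/-- The weight of a monomial `X^m`: `∏_x (wt x)^{m_x} ≥ 0`. [folklore] -/
theorem prod_wt_nonneg (m : PadicAlgCl p →₀ ℕ) : 0 ≤ m.prod fun x k => wt p x ^ k :=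
  Finset.prod_nonneg fun x _ => pow_nonneg (wt_pos p x).le _

/-- **The weighted Gauss norm** `‖Σ a_m X^m‖ := sup_m ‖a_m‖_p · ∏_x (wt x)^{m_x}` (Mathlib's `MvPowerSeries.gaussNorm` of the
polynomial seen as a power series). [folklore] -/
def gnorm (f : B p) : ℝ :=
  MvPowerSeries.gaussNorm (fun a : ℚ_[p] => ‖a‖) (wt p) (f : MvPowerSeries (PadicAlgCl p) ℚ_[p])

/-- A polynomial has finitely many coefficients, so its Gauss norm is a genuine supremum (`HasGaussNorm`). [folklore] -/
theorem hasGaussNorm (f : B p) :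
    MvPowerSeries.HasGaussNorm (fun a : ℚ_[p] => ‖a‖) (wt p) (f : MvPowerSeries (PadicAlgCl p) ℚ_[p]) := by
  classical
  refine (((f.support.image fun t => ‖coeff t f‖ * t.prod fun x k => wt p x ^ k).finite_toSet.insert 0).bddAbove).mono ?_
  rintro _ ⟨t, rfl⟩
  simp only [MvPolynomial.coeff_coe]
  by_cases ht : t ∈ f.support
  · exact Set.mem_insert_of_mem _ (Finset.mem_coe.2 (Finset.mem_image_of_mem _ ht))
  · rw [MvPolynomial.notMem_support_iff.1 ht, norm_zero, zero_mul]; exact Set.mem_insert _ _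

/-- `0 ≤ ‖f‖`. [folklore] -/
theorem gnorm_nonneg (f : B p) : 0 ≤ gnorm p f :=
  MvPowerSeries.gaussNorm_nonneg _ _ _ fun a => norm_nonneg a

/-- `‖0‖ = 0`. [folklore] -/
theorem gnorm_zero : gnorm p 0 = 0 := by
  unfold gnorm; rw [MvPolynomial.coe_zero]; exact MvPowerSeries.gaussNorm_zero _ _ norm_zero

/-- `‖f‖ = 0 ↔ f = 0` — a NORM, not a seminorm (all weights are positive). [folklore] -/
theorem gnorm_eq_zero_iff (f : B p) : gnorm p f = 0 ↔ f = 0 := by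
  unfold gnorm
  rw [MvPowerSeries.gaussNorm_eq_zero_iff _ _ _ norm_zero (fun a => norm_nonneg a) (fun x hx => norm_eq_zero.1 hx)
    (wt_pos p) (hasGaussNorm p f), MvPolynomial.coe_eq_zero_iff]

/-- ULTRAMETRICITY `‖f + g‖ ≤ max ‖f‖ ‖g‖` (Mathlib `gaussNorm_add_le_max`, `ℚ_p` being non-archimedean). [folklore] -/
theorem gnorm_add_le (f g : B p) : gnorm p (f + g) ≤ max (gnorm p f) (gnorm p g) := by
  unfold gnorm; rw [MvPolynomial.coe_add]
  exact MvPowerSeries.gaussNorm_add_le_max _ _ _ _ (fun x => (wt_pos p x).le) (fun a => norm_nonneg a)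
    IsUltrametricDist.isNonarchimedean_norm (hasGaussNorm p f) (hasGaussNorm p g)

/-- `‖−f‖ = ‖f‖`. [folklore] -/
theorem gnorm_neg (f : B p) : gnorm p (-f) = gnorm p f := by
  unfold gnorm
  rw [show ((-f : B p) : MvPowerSeries (PadicAlgCl p) ℚ_[p]) = -(f : MvPowerSeries (PadicAlgCl p) ℚ_[p]) from
    map_neg (MvPolynomial.coeToMvPowerSeries.ringHom) f]
  exact MvPowerSeries.gaussNorm_neg _ _ (fun x => norm_neg x) _

/-- SUBMULTIPLICATIVITY `‖f g‖ ≤ ‖f‖ ‖g‖` (Mathlib `gaussNorm_mul_le`: multiplicative weights, ultrametric coefficients). [folklore] -/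
theorem gnorm_mul_le (f g : B p) : gnorm p (f * g) ≤ gnorm p f * gnorm p g := by
  unfold gnorm; rw [MvPolynomial.coe_mul]
  exact MvPowerSeries.gaussNorm_mul_le _ _ _ _ (fun x => (wt_pos p x).le) (fun a => norm_nonneg a)
    (fun a b => norm_mul_le a b) IsUltrametricDist.isNonarchimedean_norm norm_zero (hasGaussNorm p f) (hasGaussNorm p g)

/-- The Gauss norm of a monomial: `‖a X^m‖ = ‖a‖_p · ∏_x (wt x)^{m_x}`. [folklore] -/
theorem gnorm_monomial (m : PadicAlgCl p →₀ ℕ) (a : ℚ_[p]) :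
    gnorm p (monomial m a) = ‖a‖ * m.prod fun x k => wt p x ^ k := by
  classical
  have key : ∀ s : PadicAlgCl p →₀ ℕ,
      ‖MvPowerSeries.coeff s ((monomial m a : B p) : MvPowerSeries (PadicAlgCl p) ℚ_[p])‖ * s.prod (fun x k => wt p x ^ k) =
        if m = s then ‖a‖ * m.prod (fun x k => wt p x ^ k) else 0 := by
    intro s
    rw [MvPolynomial.coeff_coe, MvPolynomial.coeff_monomial]
    split_ifs with h
    · rw [h]
    · rw [norm_zero, zero_mul]
  apply le_antisymm
  · refine Real.iSup_le (fun s => ?_) (mul_nonneg (norm_nonneg a) (prod_wt_nonneg p m))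
    rw [key]; split_ifs
    · exact le_rfl
    · exact mul_nonneg (norm_nonneg a) (prod_wt_nonneg p m)
  · have h := MvPowerSeries.le_gaussNorm _ _ _ (hasGaussNorm p (monomial m a)) m
    rwa [key, if_pos rfl] at h

/-- `‖X_x‖ = wt x` (`= ‖x‖` for `x ≠ 0`). [folklore] -/
theorem gnorm_X (x : PadicAlgCl p) : gnorm p (X x) = wt p x := by
  show gnorm p (monomial (Finsupp.single x 1) 1) = wt p x
  rw [gnorm_monomial, norm_one, one_mul, Finsupp.prod_single_index (h := fun y k => wt p y ^ k) (pow_zero _), pow_one]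

/-- `‖C a‖ = ‖a‖_p`: the Gauss norm extends the `p`-adic norm of the constants. [folklore] -/
theorem gnorm_C (a : ℚ_[p]) : gnorm p (C a) = ‖a‖ := by
  rw [C_apply, gnorm_monomial, Finsupp.prod_zero_index, mul_one]

/-- The Gauss norm as a Mathlib `RingNorm` (genuine norm: `‖f‖ = 0 → f = 0`). [folklore] -/
def ringNorm : RingNorm (B p) where
  toFun := gnorm p
  map_zero' := gnorm_zero p
  add_le' f g := (gnorm_add_le p f g).trans (max_le_add_of_nonneg (gnorm_nonneg p f) (gnorm_nonneg p g))
  neg' f := gnorm_neg p f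
  mul_le' f g := gnorm_mul_le p f g
  eq_zero_of_map_eq_zero' f h := (gnorm_eq_zero_iff p f).1 h

/-- **The normed-ring STRUCTURE on `B`** determined by the Gauss norm (Mathlib `RingNorm.toNormedRing`) — a DEFINITION to be used under
`letI`, never an instance (typing-lane hygiene); its underlying ring is `MvPolynomial`'s. [folklore] -/
abbrev normedCommRing : NormedCommRing (B p) :=
  { (ringNorm p).toNormedRing with mul_comm := mul_comm }

/-- Under that structure, `‖f‖` is the Gauss norm. [folklore] -/
theorem norm_def (f : B p) : (letI := normedCommRing p; ‖f‖) = gnorm p f := rfl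

/-- **The normed-`ℚ_p`-algebra STRUCTURE on `B`** (`‖a • f‖ ≤ ‖a‖_p ‖f‖`, from `a • f = C a · f`, `‖C a‖ = ‖a‖_p` and
submultiplicativity) — a definition used under `letI`; its underlying algebra is `MvPolynomial`'s. [folklore] -/
abbrev normedAlgebra : letI := normedCommRing p; NormedAlgebra ℚ_[p] (B p) :=
  letI := normedCommRing p
  { toAlgebra := inferInstance
    norm_smul_le := fun a f => by
      show gnorm p (a • f) ≤ ‖a‖ * gnorm p f
      rw [MvPolynomial.smul_eq_C_mul, ← gnorm_C p a]
      exact gnorm_mul_le p _ _ }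

/-- **`B` is ULTRAMETRIC** for the Gauss norm (Mathlib class `IsUltrametricDist`, w.r.t. the structure `normedCommRing`). [folklore] -/
theorem isUltrametricDist : letI := normedCommRing p; IsUltrametricDist (B p) := by
  letI := normedCommRing p
  exact IsUltrametricDist.isUltrametricDist_of_forall_norm_add_le_max_norm (gnorm_add_le p)

/-! ## 2. The data: Teichmüller symbols, evaluation maps `η_r`, and E-t57's point-side fields verbatim -/

open scoped Classical in
/-- The Teichmüller map `[x] := X_x` (`[0] := 0`, the only element of norm `0`). [folklore] -/
def teich (x : PadicAlgCl p) : B p := if x = 0 then 0 else X x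

/-- `[0] = 0`. [folklore] -/
theorem teich_zero : teich p 0 = 0 := by simp [teich]

/-- `[x] = X_x` for `x ≠ 0`. [folklore] -/
theorem teich_of_ne_zero {x : PadicAlgCl p} (hx : x ≠ 0) : teich p x = X x := by simp [teich, hx]

/-- `‖[x]‖ = ‖x‖` (the field `norm_teich`, for every `ρ`). [folklore] -/
theorem gnorm_teich (x : PadicAlgCl p) : gnorm p (teich p x) = ‖x‖ := by
  by_cases hx : x = 0
  · rw [hx, teich_zero, gnorm_zero, norm_zero]
  · rw [teich_of_ne_zero p hx, gnorm_X, wt_of_ne_zero p hx]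

/-- `η_r : B → K_r = Q̄_p`, the `ℚ_p`-algebra map `X_x ↦ lift r x = x · c_r(‖x‖)` (E-t57's untilt map at the point `r`). [folklore] -/
def eta (r : ℚ) : B p →+* PadicAlgCl p :=
  (MvPolynomial.aeval (R := ℚ_[p]) fun x : PadicAlgCl p => lift p r x).toRingHom

/-- `η_r(X_x) = lift r x`. [folklore] -/
theorem eta_X (r : ℚ) (x : PadicAlgCl p) : eta p r (X x) = lift p r x :=
  MvPolynomial.aeval_X _ x

/-- `lift r 0 = 0`. [folklore] -/
theorem lift_zero (r : ℚ) : lift p r 0 = 0 := by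
  unfold ExpModel.lift; rw [zero_mul]

/-- `η_r([x]) = lift r x` for every `x` (both sides vanish at `x = 0`). [folklore] -/
theorem eta_teich (r : ℚ) (x : PadicAlgCl p) : eta p r (teich p x) = lift p r x := by
  by_cases hx : x = 0
  · rw [hx, teich_zero, map_zero, lift_zero]
  · rw [teich_of_ne_zero p hx, eta_X]

/-- **The Gauss-model period-ring datum** over E-t3's signature: `B` with the Gauss norm (every `ρ`), `[x] := X_x`, `η_r := aeval lift_r`,
trivial Frobenius/Galois on `B`, `T_r := {0}`; points, scales, absolute values and embeddings = E-t57's `ExpModel.periodRingDatum`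
fields (proof terms reused). [folklore] -/
def periodRingDatum : PeriodRingDatum (PadicAlgCl p) (B p) (PadicAlgCl p) ℚ (fun _ => PadicAlgCl p) Unit where
  p := p
  p_prime := hp.out
  absF := absOne p
  norm _ f := gnorm p f
  norm_nonneg _ f := gnorm_nonneg p f
  norm_add_le _ f g := gnorm_add_le p f g
  teich := teich p
  norm_teich ρ x _ _ := by
    show gnorm p (teich p x) = absOne p x
    rw [absOne_apply, gnorm_teich]
  gal _ := id
  frob := id
  gal_norm_one _ _ h := h
  frob_norm_one _ h := h
  absK r := absPow p (sc r) (sc_pos r)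
  eta := eta p
  absK_eta_teich r x := by
    show ‖eta p r (teich p x)‖ ^ sc r = ‖x‖ ^ (1 : ℝ)
    rw [Real.rpow_one, eta_teich]
    exact norm_lift_rpow p r x
  exists_teich_lift r ξ _ := by
    obtain ⟨x, hx⟩ := lift_surjective p r ξ
    exact ⟨x, by show eta p r (teich p x) = ξ; rw [eta_teich, hx]⟩
  T _ := {0}
  zero_mem_T _ := rfl
  eta_T r τ hτ := by rw [Set.mem_singleton_iff.1 hτ]; exact map_zero _
  T_norm_one r τ hτ := by
    show gnorm p τ ≤ 1
    rw [Set.mem_singleton_iff.1 hτ, gnorm_zero]; exact zero_le_one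
  pt := expQ p
  frobY r := p * r
  pt_frob := (ExpModel.periodRingDatum p).pt_frob
  galF _ := RingHom.id _
  absF_galF _ _ := rfl
  galY _ := id
  pt_gal _ _ := rfl
  abs0 := absOne p
  abs0_p := (ExpModel.periodRingDatum p).abs0_p
  emb _ := RingHom.id _
  scale r := sc r
  scale_pos r := sc_pos r
  absK_emb := (ExpModel.periodRingDatum p).absK_emb
  absK_pt := (ExpModel.periodRingDatum p).absK_pt

/-- **The Gauss-model prototype datum**: `ℓ⋆ := 2`, `q := p^{10}`, `ξ := p` — E-t57's choices and proofs verbatim. [folklore] -/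
def prototypeDatum : PrototypeDatum (PadicAlgCl p) (B p) (PadicAlgCl p) ℚ (fun _ => PadicAlgCl p) Unit where
  toPeriodRingDatum := periodRingDatum p
  lstar := 2
  one_le_lstar := by norm_num
  q := (ExpModel.prototypeDatum p).q
  abs0_q := (ExpModel.prototypeDatum p).abs0_q
  xi := (ExpModel.prototypeDatum p).xi
  abs0_xi := (ExpModel.prototypeDatum p).abs0_xi

/-- **The Gauss-model canonical point**: `t := p`, `a := p^{1/4}` — E-t57's `ExpModel.canonicalPoint` fields verbatim (the
`CanonicalPoint` signature does not mention `B`). [folklore] -/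
def canonicalPoint : (prototypeDatum p).CanonicalPoint where
  t := (ExpModel.canonicalPoint p).t
  t_ne_zero := (ExpModel.canonicalPoint p).t_ne_zero
  absF_t_lt_one := (ExpModel.canonicalPoint p).absF_t_lt_one
  scale_pt_t := (ExpModel.canonicalPoint p).scale_pt_t
  a := (ExpModel.canonicalPoint p).a
  a_pow := (ExpModel.canonicalPoint p).a_pow

/-! ## 3. Non-vacuity of p437653's hypotheses and Thm. 7.7.3.1 at `p` instantiated -/

/-- **`hn` HOLDS IN THE MODEL, by `rfl`**: the prototype's Fréchet norm at every `ρ` IS the norm of the normed-ring structure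
`normedCommRing` (the hypothesis `hn` of `crossNormAt_ofPrototypes_of_norm_eq` / `localFundamentalEstimate_ofPrototypes_padic`). [folklore] -/
theorem norm_eq (ρ : ℝ) (f : B p) : (prototypeDatum p).norm ρ f = (letI := normedCommRing p; ‖f‖) := rfl

/-- **NON-VACUITY (closes HONEST LIMIT (b) of p437653)**: over the ultrametric normed `ℚ_p`-algebra `(B, ‖·‖_Gauss)` there are an E-t3
prototype datum WITH a canonical point whose Fréchet norms are the algebra norm at every `ρ` — the hypotheses «E-t3's signature +
`CanonicalPoint` + `hn`» of Thm. 7.7.3.1-with-inputs-discharged are JOINTLY satisfiable. [folklore] -/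
theorem hypotheses_satisfiable :
    letI := normedCommRing p
    ∃ P : PrototypeDatum (PadicAlgCl p) (B p) (PadicAlgCl p) ℚ (fun _ => PadicAlgCl p) Unit,
      Nonempty P.CanonicalPoint ∧ (∀ (ρ : ℝ) (f : B p), P.norm ρ f = ‖f‖) ∧
        IsUltrametricDist (B p) ∧ Nonempty (NormedAlgebra ℚ_[p] (B p)) :=
  ⟨prototypeDatum p, ⟨canonicalPoint p⟩, norm_eq p, isUltrametricDist p, ⟨normedAlgebra p⟩⟩

/-- **THEOREM 7.7.3.1 AT `p`, BOTH PRINTED INPUTS DISCHARGED, EVERY REMAINING HYPOTHESIS DISCHARGED** — p437653's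
`localFundamentalEstimate_ofPrototypes_padic` INSTANTIATED: one place above `p` (`𝕍_p = 𝕍^{odd,ss}_p = {⋆}`), `E′_⋆ := ℚ_p`, `B_p := ℚ_p`,
comparison map `0`, the Gauss-model prototype datum and canonical point at `⋆`, the literal tensor ring `⨂[ℚ_p] B` with the pure-tensor
map and its norm, `ρ = 1`, and `hn` by `rfl`. Hence the typed estimate `|Θ̃^{B̆⊗}_{Joshi,p}|_{B̆⊗} ≥ ∏_w |q_w^{1/2ℓ}|^{ℓ⋇}` (7.2.9)-form
holds of an ACTUAL datum: the class of data about which this seat's Thm. 7.7.3.1 speaks is non-empty. No claim about Joshi's or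
Mochizuki's mathematics. [folklore] -/
theorem localFundamentalEstimate_gaussModel :
    letI := normedCommRing p
    letI := normedAlgebra p
    haveI := isUltrametricDist p
    (ATS3.PrimeBundlingDatum.ofPrototypes (Bp := ℚ_[p]) (E := fun _ : Unit => ℚ_[p])
        (fun _ : Unit => prototypeDatum p) (fun _ => rfl) Finset.univ Finset.univ (Finset.Subset.refl _)
        (fun _ => (0 : B p →ₗ[ℚ_[p]] ℚ_[p] ⊗[ℚ_[p]] ℚ_[p]))
        (PiTensorProduct.tprodMonoidHom ℚ_[p])
        (fun _ (t : PiTensorProduct ℚ_[p] fun _ : (Finset.univ : Finset Unit) => B p) => ‖t‖)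
        (fun _ t => norm_nonneg t)).LocalFundamentalEstimate := by
  letI := normedCommRing p
  letI := normedAlgebra p
  haveI := isUltrametricDist p
  exact ATS3.PrimeBundlingDatum.localFundamentalEstimate_ofPrototypes_padic (fun _ : Unit => prototypeDatum p) (fun _ => rfl)
    Finset.univ Finset.univ (Finset.Subset.refl _) _ (fun _ => canonicalPoint p) (ρ := 1) ⟨one_pos, le_rfl⟩ (fun _ _ _ => rfl)

end Summit.ABC.IUTFork.Joshi.GaussModel

end
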